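import Mathlib

/-!
# ROW C-041 — THE CLOSURE LEMMA of the tree theorem (mine-3, gen 57; C-041.md §15 (d) and §19)

The tree theorem of C-041.md §15 (d): every rooted marked tree zone with one anchor satisfies (P) —
with `g = #{all red}`, `t1 = #{type 1}`, `t2 = #{type 2}`, `k = #{invalid}`: `(g − k)² ≤ t1·t2`, `0 ≤ k ≤ g`.
By the recursion of §15 (c) the counts of a root with marks `(p, q)` and children `c_j = (g_j, t1_j, t2_j, k_j)`
are read off the pointwise product of the six-vectors `ell c_j = (2g + t1 + t2, 2g + 2t1 + t2, 2g + t1 + 2t2,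
g + k, g + t1 + k, g + t2 + k)`, of `p` copies of `v 1 = (1, 2, 1, 0, 1, 0)` and `q` copies of
`v 0 = (1, 1, 2, 0, 0, 1)` («marks are children», §19 (a)): `g = w₀`, `t1 = w₁ − w₀`, `t2 = w₂ − w₀`,
`k = w₄ + w₅ − w₃`. This file proves the CLOSURE LEMMA (§19 (d)): children in 𝒦 give a root in 𝒦, for every
`(p, q)` and every number of children. `K4` is the cone 𝒦 (a convex cone: `K4.add`, `K4.smul`);
`v a = (1, 1 + a², 1 + (1 − a)², a(1 − a), a, 1 − a)` are the generators and `V a = ∏ v (a i)` the pure roots;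
**`U_ineq`** is the one inequality `((1 − ∏a)(1 − ∏(1 − a)))² ≤ (∏(1 + a²) − 1)(∏(1 + (1 − a)²) − 1)` on
`[0, 1]^m` (Cauchy–Schwarz with the complement pairing, §19 (c)); `K4v_V`: pure roots lie in 𝒦; `InCone`: the
cone they generate, `K4v_of_InCone`; `ell_decomp` is the DECOMPOSITION LEMMA `ell c = α•v a + β•1 + γ•v 1 + δ•v 0`
(§19 (b)), whence `InCone.mul_ell`; **`closure_K4v`** (product form) and **`root_K4`** (the four-case form of
§15 (c)) are the closure lemma; `zoneOCube_nonneg_of_K4` is the AM–GM corollary `0 ≤ t1 + t2 + 2k − 2g`.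
Everything is over `ℝ`; the dictionary recursion = counts (§15 (i)) is a separate combinatorial module.
-/

namespace PercRepro

namespace TreeClosure

open Finset

/-- The cone 𝒦 of C-041.md §15 (d): a 4-vector `(g, t1, t2, k)` satisfies (P) when `t1, t2 ≥ 0`,
`0 ≤ k ≤ g` and `(g − k)² ≤ t1·t2`. -/
structure K4 (g t1 t2 k : ℝ) : Prop where
  t1_nonneg : 0 ≤ t1
  t2_nonneg : 0 ≤ t2
  k_nonneg : 0 ≤ k
  k_le_g : k ≤ g
  cs : (g - k) ^ 2 ≤ t1 * t2

/-- The two-term Cauchy–Schwarz step: `u² ≤ ab` and `u′² ≤ a′b′` give `(u + u′)² ≤ (a + a′)(b + b′)`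
(all quantities non-negative). -/
theorem sq_add_le_mul_add {u u' a b a' b' : ℝ} (hu : 0 ≤ u) (hu' : 0 ≤ u') (ha : 0 ≤ a) (hb : 0 ≤ b)
    (ha' : 0 ≤ a') (hb' : 0 ≤ b') (h : u ^ 2 ≤ a * b) (h' : u' ^ 2 ≤ a' * b') :
    (u + u') ^ 2 ≤ (a + a') * (b + b') := by
  have h1 : u ^ 2 * u' ^ 2 ≤ (a * b) * (a' * b') :=
    mul_le_mul h h' (sq_nonneg _) (mul_nonneg ha hb)
  have h2 : (2 * u * u') ^ 2 ≤ (a * b' + a' * b) ^ 2 := by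
    nlinarith [sq_nonneg (a * b' - a' * b)]
  have h3 : 2 * u * u' ≤ a * b' + a' * b :=
    (sq_le_sq₀ (by positivity) (by positivity)).1 h2
  nlinarith

/-- 𝒦 is closed under addition. -/
theorem K4.add {g t1 t2 k g' t1' t2' k' : ℝ} (h : K4 g t1 t2 k) (h' : K4 g' t1' t2' k') :
    K4 (g + g') (t1 + t1') (t2 + t2') (k + k') where
  t1_nonneg := add_nonneg h.t1_nonneg h'.t1_nonneg
  t2_nonneg := add_nonneg h.t2_nonneg h'.t2_nonneg
  k_nonneg := add_nonneg h.k_nonneg h'.k_nonneg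
  k_le_g := add_le_add h.k_le_g h'.k_le_g
  cs := by
    have e : g + g' - (k + k') = (g - k) + (g' - k') := by ring
    rw [e]
    exact sq_add_le_mul_add (sub_nonneg.2 h.k_le_g) (sub_nonneg.2 h'.k_le_g) h.t1_nonneg h.t2_nonneg
      h'.t1_nonneg h'.t2_nonneg h.cs h'.cs

/-- 𝒦 is closed under non-negative scaling. -/
theorem K4.smul {g t1 t2 k : ℝ} (h : K4 g t1 t2 k) {c : ℝ} (hc : 0 ≤ c) :
    K4 (c * g) (c * t1) (c * t2) (c * k) where
  t1_nonneg := mul_nonneg hc h.t1_nonneg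
  t2_nonneg := mul_nonneg hc h.t2_nonneg
  k_nonneg := mul_nonneg hc h.k_nonneg
  k_le_g := mul_le_mul_of_nonneg_left h.k_le_g hc
  cs := by
    calc (c * g - c * k) ^ 2 = c ^ 2 * (g - k) ^ 2 := by ring
      _ ≤ c ^ 2 * (t1 * t2) := by gcongr; exact h.cs
      _ = (c * t1) * (c * t2) := by ring

/-- Six-vectors `(L₀, L₁, L₂, M₀, M₁, M₂)` with the pointwise product. -/
abbrev Vec6 := Fin 6 → ℝ

/-- The generator `v a = (1, 1 + a², 1 + b², ab, a, b)`, `b = 1 − a` (C-041.md §19 (b)): for `a ∈ (0, 1)` it is the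
ℓ-vector of the fugacity-deformed leaf `E_s = (1, s, 1/s, 0)`, `a = s/(1 + s)`, up to the factor `ab`; `v 1` is the
1-mark atom `E₁`, `v 0` the 2-mark atom `E₂`. -/
def v (a : ℝ) : Vec6 := ![1, 1 + a ^ 2, 1 + (1 - a) ^ 2, a * (1 - a), a, 1 - a]

/-- The pure root `V a = v (a 0) ∘ ⋯ ∘ v (a (m−1))` (pointwise product). -/
def V {m : ℕ} (a : Fin m → ℝ) : Vec6 := ∏ i, v (a i)

/-- The ℓ-vector of a child `(g, t1, t2, k)` (C-041.md §15 (j)). -/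
def ell (g t1 t2 k : ℝ) : Vec6 :=
  ![2 * g + t1 + t2, 2 * g + 2 * t1 + t2, 2 * g + t1 + 2 * t2, g + k, g + t1 + k, g + t2 + k]

/-- The root's 4-vector of a six-vector `w`: `(w₀, w₁ − w₀, w₂ − w₀, w₄ + w₅ − w₃)` lies in 𝒦. -/
def K4v (w : Vec6) : Prop := K4 (w 0) (w 1 - w 0) (w 2 - w 0) (w 4 + w 5 - w 3)

/-- Coordinate `L₀` of a generator. -/ theorem v_zero (a : ℝ) : v a 0 = 1 := rfl
/-- Coordinate `L₁` of a generator. -/ theorem v_one (a : ℝ) : v a 1 = 1 + a ^ 2 := rfl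
/-- Coordinate `L₂` of a generator. -/ theorem v_two (a : ℝ) : v a 2 = 1 + (1 - a) ^ 2 := rfl
/-- Coordinate `M₀` of a generator. -/ theorem v_three (a : ℝ) : v a 3 = a * (1 - a) := rfl
/-- Coordinate `M₁` of a generator. -/ theorem v_four (a : ℝ) : v a 4 = a := rfl
/-- Coordinate `M₂` of a generator. -/ theorem v_five (a : ℝ) : v a 5 = 1 - a := rfl

/-- **(U_m)**: for `a ∈ [0, 1]^m`, `((1 − ∏a)(1 − ∏(1 − a)))² ≤ (∏(1 + a²) − 1)(∏(1 + (1 − a)²) − 1)`.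
Proof: `∑_S A_S B_{Sᶜ} = ∏(a + b) = 1`, so `(1 − A)(1 − B) = ∑_{S ≠ ∅} A_S B_{T(S)}` with `T` the complement on
the proper non-empty subsets and `T([m]) = [m]`; then Cauchy–Schwarz. -/
theorem U_ineq {m : ℕ} (a : Fin m → ℝ) (ha : ∀ i, 0 ≤ a i ∧ a i ≤ 1) :
    ((1 - ∏ i, a i) * (1 - ∏ i, (1 - a i))) ^ 2
      ≤ (∏ i, (1 + a i ^ 2) - 1) * (∏ i, (1 + (1 - a i) ^ 2) - 1) := by
  classical
  cases m with
  | zero => simp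
  | succ n =>
    -- notation
    set b : Fin (n + 1) → ℝ := fun i => 1 - a i with hb
    set A : Finset (Fin (n + 1)) → ℝ := fun S => ∏ i ∈ S, a i with hA
    set B : Finset (Fin (n + 1)) → ℝ := fun S => ∏ i ∈ S, b i with hB
    have hAu : A univ = ∏ i, a i := rfl
    have hBu : B univ = ∏ i, (1 - a i) := rfl
    -- the three expansions
    have e1 : (∑ S : Finset (Fin (n + 1)), A S * B (univ \ S)) = 1 := by
      have := Finset.prod_add a b (univ : Finset (Fin (n + 1)))
      rw [Finset.powerset_univ] at this
      rw [hA, hB]; simp only []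
      rw [← this]; simp [hb]
    have e2 : (∑ S : Finset (Fin (n + 1)), A S ^ 2) = ∏ i, (1 + a i ^ 2) := by
      have := Finset.prod_add (fun i => a i ^ 2) (fun _ => (1 : ℝ)) (univ : Finset (Fin (n + 1)))
      rw [Finset.powerset_univ] at this
      simp only [Finset.prod_const_one, mul_one, Finset.prod_pow] at this
      rw [hA]; simp only []
      rw [← this]; exact Finset.prod_congr rfl (fun i _ => by ring)
    have e3 : (∑ S : Finset (Fin (n + 1)), B (univ \ S) ^ 2) = ∏ i, (1 + (1 - a i) ^ 2) := by
      have := Finset.prod_add (fun _ => (1 : ℝ)) (fun i => b i ^ 2) (univ : Finset (Fin (n + 1)))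
      rw [Finset.powerset_univ] at this
      simp only [Finset.prod_const_one, one_mul, Finset.prod_pow] at this
      rw [hB]; simp only []
      rw [← this]
    -- peeling the two special subsets ∅ and univ
    have hne : (univ : Finset (Fin (n + 1))) ≠ ∅ := Finset.univ_nonempty.ne_empty
    have peel : ∀ h : Finset (Fin (n + 1)) → ℝ,
        (∑ S, h S) = h ∅ + h univ + ∑ S ∈ (univ.erase ∅).erase univ, h S := by
      intro h
      rw [← Finset.add_sum_erase univ h (Finset.mem_univ ∅),
        ← Finset.add_sum_erase (univ.erase ∅) h (Finset.mem_erase.2 ⟨hne, Finset.mem_univ _⟩), add_assoc]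
    have mem_rest : ∀ S ∈ (univ.erase (∅ : Finset (Fin (n + 1)))).erase univ, S ≠ univ ∧ S ≠ ∅ := by
      intro S hS
      exact ⟨(Finset.mem_erase.1 hS).1, (Finset.mem_erase.1 (Finset.mem_erase.1 hS).2).1⟩
    -- the paired vectors
    set f : Finset (Fin (n + 1)) → ℝ := fun S => if S = ∅ then 0 else A S with hf
    set g : Finset (Fin (n + 1)) → ℝ :=
      fun S => if S = ∅ then 0 else if S = univ then B univ else B (univ \ S) with hg
    have hA0 : A ∅ = 1 := by simp [hA]
    have hB0 : B ∅ = 1 := by simp [hB]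
    have s1 : 1 = B univ + A univ + ∑ S ∈ (univ.erase ∅).erase univ, A S * B (univ \ S) := by
      rw [← e1, peel (fun S => A S * B (univ \ S))]
      simp [hA0, hB0]
    have s2 : (∑ S, f S * g S) = A univ * B univ + ∑ S ∈ (univ.erase ∅).erase univ, A S * B (univ \ S) := by
      rw [peel (fun S => f S * g S)]
      have : ∑ S ∈ (univ.erase ∅).erase univ, f S * g S
          = ∑ S ∈ (univ.erase ∅).erase univ, A S * B (univ \ S) := by
        refine Finset.sum_congr rfl (fun S hS => ?_)
        obtain ⟨h1, h2⟩ := mem_rest S hS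
        simp [hf, hg, h1, h2]
      rw [this]
      simp [hf, hg, hne]
    have s3 : (∑ S, f S ^ 2) = ∏ i, (1 + a i ^ 2) - 1 := by
      rw [← e2, peel (fun S => f S ^ 2), peel (fun S => A S ^ 2)]
      have : ∑ S ∈ (univ.erase ∅).erase univ, f S ^ 2 = ∑ S ∈ (univ.erase ∅).erase univ, A S ^ 2 := by
        refine Finset.sum_congr rfl (fun S hS => ?_)
        obtain ⟨_, h2⟩ := mem_rest S hS
        simp [hf, h2]
      rw [this]
      simp [hf, hA0, hne]
    have s4 : (∑ S, g S ^ 2) = ∏ i, (1 + (1 - a i) ^ 2) - 1 := by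
      rw [← e3, peel (fun S => g S ^ 2), peel (fun S => B (univ \ S) ^ 2)]
      have : ∑ S ∈ (univ.erase ∅).erase univ, g S ^ 2
          = ∑ S ∈ (univ.erase ∅).erase univ, B (univ \ S) ^ 2 := by
        refine Finset.sum_congr rfl (fun S hS => ?_)
        obtain ⟨h1, h2⟩ := mem_rest S hS
        simp [hg, h1, h2]
      rw [this]
      simp [hg, hB0, hne]
      ring
    -- Cauchy–Schwarz
    have key : (1 - A univ) * (1 - B univ) = ∑ S, f S * g S := by
      rw [s2]
      linear_combination s1
    have cs := Finset.sum_mul_sq_le_sq_mul_sq (univ : Finset (Finset (Fin (n + 1)))) f g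
    rw [← hAu, ← hBu, key, s3, s4] at *
    exact cs


/-- The coordinates of a pure root are the products of the coordinates. -/
theorem V_apply {m : ℕ} (a : Fin m → ℝ) (j : Fin 6) : V a j = ∏ i, v (a i) j := by
  simp [V, Finset.prod_apply]

/-- Every pure root `V a`, `a ∈ [0, 1]^m`, satisfies (P) (C-041.md §19 (c)). -/
theorem K4v_V {m : ℕ} (a : Fin m → ℝ) (ha : ∀ i, 0 ≤ a i ∧ a i ≤ 1) : K4v (V a) := by
  have h0 : V a 0 = 1 := by simp [V_apply, v_zero]
  have h1 : V a 1 = ∏ i, (1 + a i ^ 2) := by simp [V_apply, v_one]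
  have h2 : V a 2 = ∏ i, (1 + (1 - a i) ^ 2) := by simp [V_apply, v_two]
  have h3 : V a 3 = (∏ i, a i) * ∏ i, (1 - a i) := by
    simp [V_apply, v_three, Finset.prod_mul_distrib]
  have h4 : V a 4 = ∏ i, a i := by simp [V_apply, v_four]
  have h5 : V a 5 = ∏ i, (1 - a i) := by simp [V_apply, v_five]
  have hA0 : 0 ≤ ∏ i, a i := Finset.prod_nonneg (fun i _ => (ha i).1)
  have hA1 : ∏ i, a i ≤ 1 := Finset.prod_le_one (fun i _ => (ha i).1) (fun i _ => (ha i).2)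
  have hB0 : 0 ≤ ∏ i, (1 - a i) := Finset.prod_nonneg (fun i _ => by linarith [(ha i).2])
  have hB1 : ∏ i, (1 - a i) ≤ 1 :=
    Finset.prod_le_one (fun i _ => by linarith [(ha i).2]) (fun i _ => by linarith [(ha i).1])
  have hP1 : 1 ≤ ∏ i, (1 + a i ^ 2) := by
    calc (1 : ℝ) = ∏ _i : Fin m, (1 : ℝ) := by simp
      _ ≤ ∏ i, (1 + a i ^ 2) :=
        Finset.prod_le_prod (fun _ _ => zero_le_one) (fun i _ => by nlinarith [sq_nonneg (a i)])
  have hP2 : 1 ≤ ∏ i, (1 + (1 - a i) ^ 2) := by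
    calc (1 : ℝ) = ∏ _i : Fin m, (1 : ℝ) := by simp
      _ ≤ ∏ i, (1 + (1 - a i) ^ 2) :=
        Finset.prod_le_prod (fun _ _ => zero_le_one) (fun i _ => by nlinarith [sq_nonneg (1 - a i)])
  unfold K4v
  rw [h0, h1, h2, h3, h4, h5]
  refine ⟨by linarith, by linarith, ?_, ?_, ?_⟩
  · nlinarith [mul_nonneg hA0 (sub_nonneg.2 hB1)]
  · nlinarith [mul_nonneg (sub_nonneg.2 hA1) (sub_nonneg.2 hB1)]
  · have e : (1 - (∏ i, a i + ∏ i, (1 - a i) - (∏ i, a i) * ∏ i, (1 - a i)))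
        = (1 - ∏ i, a i) * (1 - ∏ i, (1 - a i)) := by ring
    rw [e]
    exact U_ineq a ha


/-- The convex cone generated by the pure roots `V a`, `a ∈ [0, 1]^m`. -/
inductive InCone : Vec6 → Prop
  | pure {m : ℕ} (a : Fin m → ℝ) (ha : ∀ i, 0 ≤ a i ∧ a i ≤ 1) : InCone (V a)
  | add {x y : Vec6} : InCone x → InCone y → InCone (x + y)
  | smul {x : Vec6} (c : ℝ) (hc : 0 ≤ c) : InCone x → InCone (c • x)

/-- The root's 4-vector of every element of the cone lies in 𝒦. -/
theorem K4v_of_InCone {w : Vec6} (h : InCone w) : K4v w := by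
  induction h with
  | pure a ha => exact K4v_V a ha
  | add _ _ ihx ihy =>
    unfold K4v at *
    have := ihx.add ihy
    convert this using 1 <;> simp only [Pi.add_apply] <;> ring
  | smul c hc _ ih =>
    unfold K4v at *
    have := ih.smul hc
    convert this using 1 <;> simp only [Pi.smul_apply, smul_eq_mul] <;> ring

/-- The constant vector `1` is the empty pure root. -/
theorem InCone_one : InCone (1 : Vec6) := by
  have h := InCone.pure (fun i : Fin 0 => (0 : ℝ)) (fun i => i.elim0)
  have e : V (fun i : Fin 0 => (0 : ℝ)) = 1 := by simp [V]
  rwa [e] at h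

/-- Appending a generator to a pure root. -/
theorem V_snoc {m : ℕ} (a : Fin m → ℝ) (x : ℝ) :
    V (Fin.snoc a x : Fin (m + 1) → ℝ) = V a * v x := by
  unfold V
  rw [Fin.prod_univ_castSucc]
  simp [Fin.snoc_castSucc, Fin.snoc_last]

/-- The cone is closed under the product with a generator. -/
theorem InCone.mul_v {w : Vec6} (h : InCone w) {x : ℝ} (hx0 : 0 ≤ x) (hx1 : x ≤ 1) :
    InCone (w * v x) := by
  induction h with
  | pure a ha =>
    rw [← V_snoc]
    refine InCone.pure _ (fun i => ?_)
    refine Fin.lastCases ?_ (fun j => ?_) i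
    · simp [Fin.snoc_last, hx0, hx1]
    · simp [Fin.snoc_castSucc, ha j]
  | add _ _ ihx ihy =>
    rw [add_mul]
    exact ihx.add ihy
  | smul c hc _ ih =>
    rw [smul_mul_assoc]
    exact ih.smul c hc

/-- The cone is closed under the product with a power of a generator. -/
theorem InCone.mul_pow_v {w : Vec6} (h : InCone w) {x : ℝ} (hx0 : 0 ≤ x) (hx1 : x ≤ 1) (p : ℕ) :
    InCone (w * v x ^ p) := by
  induction p with
  | zero => simpa using h
  | succ n ih =>
    rw [pow_succ, ← mul_assoc]
    exact ih.mul_v hx0 hx1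


/-- **DECOMPOSITION LEMMA**: for `c ∈ 𝒦`, `ell c = α•v a + β•1 + γ•v 1 + δ•v 0` with non-negative coefficients
and `a ∈ [0, 1]` (`a = t1/(g − k + t1)`, `α = (g − k + t1)²/t1`, `β = 2k`, `γ = 0`, `δ = t2 − (g − k)²/t1` when
`t1 > 0`; `t1 = 0` forces `g = k` and `ell c = 2g•1 + t2•v 0`). -/
theorem ell_decomp {g t1 t2 k : ℝ} (h : K4 g t1 t2 k) :
    ∃ α β γ δ a : ℝ, 0 ≤ α ∧ 0 ≤ β ∧ 0 ≤ γ ∧ 0 ≤ δ ∧ 0 ≤ a ∧ a ≤ 1 ∧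
      ell g t1 t2 k = α • v a + β • (1 : Vec6) + γ • v 1 + δ • v 0 := by
  obtain ⟨ht1, ht2, hk, hkg, hcs⟩ := h
  rcases eq_or_lt_of_le ht1 with h0 | hpos
  · have h2 : (g - k) ^ 2 = 0 := by
      refine le_antisymm ?_ (sq_nonneg _)
      rw [← h0] at hcs
      simpa using hcs
    have hgk : g - k = 0 := pow_eq_zero_iff (two_ne_zero) |>.1 h2
    refine ⟨0, 2 * g, 0, t2, 0, le_rfl, by linarith, le_rfl, ht2, le_rfl, zero_le_one, ?_⟩
    have hg : g = k := by linarith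
    funext j
    simp only [Pi.add_apply, Pi.smul_apply, Pi.one_apply, smul_eq_mul]
    fin_cases j <;> simp [ell, v, ← h0, hg] <;> ring
  · have hu0 : 0 ≤ g - k := sub_nonneg.2 hkg
    refine ⟨(g - k + t1) ^ 2 / t1, 2 * k, 0, t2 - (g - k) ^ 2 / t1, t1 / (g - k + t1),
      div_nonneg (sq_nonneg _) ht1, by linarith, le_rfl, ?_, div_nonneg ht1 (by linarith), ?_, ?_⟩
    · rw [sub_nonneg, div_le_iff₀ hpos]
      linarith [hcs]
    · rw [div_le_one (by linarith)]
      linarith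
    · funext j
      simp only [Pi.add_apply, Pi.smul_apply, Pi.one_apply, smul_eq_mul]
      fin_cases j <;> simp [ell, v] <;> field_simp <;> ring

/-- The cone is closed under the product with the ℓ-vector of a child in 𝒦. -/
theorem InCone.mul_ell {w : Vec6} (hw : InCone w) {g t1 t2 k : ℝ} (hc : K4 g t1 t2 k) :
    InCone (w * ell g t1 t2 k) := by
  obtain ⟨α, β, γ, δ, a, hα, hβ, hγ, hδ, ha0, ha1, he⟩ := ell_decomp hc
  rw [he]
  have e : w * (α • v a + β • (1 : Vec6) + γ • v 1 + δ • v 0)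
      = α • (w * v a) + β • w + γ • (w * v 1) + δ • (w * v 0) := by
    simp only [mul_add, mul_smul_comm, mul_one]
  rw [e]
  exact ((((hw.mul_v ha0 ha1).smul α hα).add (hw.smul β hβ)).add
    ((hw.mul_v zero_le_one le_rfl).smul γ hγ)).add ((hw.mul_v le_rfl zero_le_one).smul δ hδ)

/-- The product of the ℓ-vectors of children in 𝒦 lies in the cone. -/
theorem InCone_prod_ell :
    ∀ (d : ℕ) (g t1 t2 k : Fin d → ℝ), (∀ j, K4 (g j) (t1 j) (t2 j) (k j)) →
      InCone (∏ j, ell (g j) (t1 j) (t2 j) (k j)) := by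
  intro d
  induction d with
  | zero =>
    intro g t1 t2 k _
    simpa using InCone_one
  | succ n ih =>
    intro g t1 t2 k hc
    rw [Fin.prod_univ_castSucc]
    exact (ih (fun j => g j.castSucc) (fun j => t1 j.castSucc) (fun j => t2 j.castSucc)
      (fun j => k j.castSucc) (fun j => hc _)).mul_ell (hc _)


/-- **THE CLOSURE LEMMA (C-041.md §19 (d))**, product form: if the children `(g j, t1 j, t2 j, k j)` lie in 𝒦,
the root with `p` 1-marks and `q` 2-marks — the six-vector `∏ ell c_j ∘ v 1 ^ p ∘ v 0 ^ q` — has its 4-vector in 𝒦. -/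
theorem closure_K4v (d : ℕ) (g t1 t2 k : Fin d → ℝ) (hc : ∀ j, K4 (g j) (t1 j) (t2 j) (k j)) (p q : ℕ) :
    K4v ((∏ j, ell (g j) (t1 j) (t2 j) (k j)) * v 1 ^ p * v 0 ^ q) :=
  K4v_of_InCone
    (((InCone_prod_ell d g t1 t2 k hc).mul_pow_v zero_le_one le_rfl p).mul_pow_v le_rfl zero_le_one q)

/-- Coordinate `L₀` of an ℓ-vector. -/ theorem ell_zero (g t1 t2 k : ℝ) : ell g t1 t2 k 0 = 2 * g + t1 + t2 := rfl
/-- Coordinate `L₁` of an ℓ-vector. -/ theorem ell_one (g t1 t2 k : ℝ) : ell g t1 t2 k 1 = 2 * g + 2 * t1 + t2 := rfl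
/-- Coordinate `L₂` of an ℓ-vector. -/ theorem ell_two (g t1 t2 k : ℝ) : ell g t1 t2 k 2 = 2 * g + t1 + 2 * t2 := rfl
/-- Coordinate `M₀` of an ℓ-vector. -/ theorem ell_three (g t1 t2 k : ℝ) : ell g t1 t2 k 3 = g + k := rfl
/-- Coordinate `M₁` of an ℓ-vector. -/ theorem ell_four (g t1 t2 k : ℝ) : ell g t1 t2 k 4 = g + t1 + k := rfl
/-- Coordinate `M₂` of an ℓ-vector. -/ theorem ell_five (g t1 t2 k : ℝ) : ell g t1 t2 k 5 = g + t2 + k := rfl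

/-- `0 ^ n` as an indicator. -/
theorem zero_pow_ite (n : ℕ) : (0 : ℝ) ^ n = if n = 0 then 1 else 0 := by
  rcases Nat.eq_zero_or_pos n with hn | hn
  · simp [hn]
  · simp [hn.ne', zero_pow hn.ne']

/-- **THE CLOSURE LEMMA in the vocabulary of C-041.md §15 (c)**: with children `(g j, t1 j, t2 j, k j) ∈ 𝒦`, the
root with marks `(p, q)` has `g = ∏(2g_j + t1_j + t2_j)`, `t1 = 2^p ∏(2g_j + 2t1_j + t2_j) − g`,
`t2 = 2^q ∏(2g_j + t1_j + 2t2_j) − g` and `k = [q = 0]·∏(g_j + t1_j + k_j) + [p = 0]·∏(g_j + t2_j + k_j)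
− [p = q = 0]·∏(g_j + k_j)` (the four cases of the recursion at once), and this 4-vector lies in 𝒦. -/
theorem root_K4 (d : ℕ) (g t1 t2 k : Fin d → ℝ) (hc : ∀ j, K4 (g j) (t1 j) (t2 j) (k j)) (p q : ℕ) :
    K4 (∏ j, (2 * g j + t1 j + t2 j))
      (2 ^ p * ∏ j, (2 * g j + 2 * t1 j + t2 j) - ∏ j, (2 * g j + t1 j + t2 j))
      (2 ^ q * ∏ j, (2 * g j + t1 j + 2 * t2 j) - ∏ j, (2 * g j + t1 j + t2 j))
      ((if q = 0 then ∏ j, (g j + t1 j + k j) else 0) + (if p = 0 then ∏ j, (g j + t2 j + k j) else 0)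
        - (if p = 0 ∧ q = 0 then ∏ j, (g j + k j) else 0)) := by
  have h := closure_K4v d g t1 t2 k hc p q
  unfold K4v at h
  have e : ∀ j : Fin 6, ((∏ i, ell (g i) (t1 i) (t2 i) (k i)) * v 1 ^ p * v 0 ^ q) j
      = (∏ i, ell (g i) (t1 i) (t2 i) (k i) j) * v 1 j ^ p * v 0 j ^ q := by
    intro j
    simp [Finset.prod_apply, Pi.mul_apply, Pi.pow_apply]
  simp only [e, ell_zero, ell_one, ell_two, ell_three, ell_four, ell_five, v_zero, v_one, v_two, v_three,
    v_four, v_five] at h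
  norm_num [zero_pow_ite] at h
  have e1 : (∏ x, (2 * g x + 2 * t1 x + t2 x)) * 2 ^ p = 2 ^ p * ∏ x, (2 * g x + 2 * t1 x + t2 x) :=
    mul_comm _ _
  have e2 : (∏ x, (2 * g x + t1 x + 2 * t2 x)) * 2 ^ q = 2 ^ q * ∏ x, (2 * g x + t1 x + 2 * t2 x) :=
    mul_comm _ _
  have e3 : (if q = 0 then if p = 0 then ∏ x, (g x + k x) else 0 else 0)
      = if p = 0 ∧ q = 0 then ∏ x, (g x + k x) else 0 := by
    by_cases hp : p = 0 <;> by_cases hq : q = 0 <;> simp [hp, hq]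
  rw [e1, e2, e3] at h
  exact h

/-- The AM–GM corollary: (P) gives the ZONE O-CUBE weight `t1 + t2 + 2k − 2g ≥ 0` (C-041.md §15 (d)). -/
theorem zoneOCube_nonneg_of_K4 {g t1 t2 k : ℝ} (h : K4 g t1 t2 k) : 0 ≤ t1 + t2 + 2 * k - 2 * g := by
  obtain ⟨ht1, ht2, _, hkg, hcs⟩ := h
  nlinarith [sq_nonneg (t1 - t2), sq_nonneg (t1 + t2 - 2 * (g - k))]

end TreeClosure

end PercRepro
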